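import Literature.MathematicalPhysics.QuantumFieldTheory.Balaban1983to89.B1GaussNorm339

/-!
# `Balaban1983to89.B1Eq369GaussRatio` — T. Bałaban, *(Higgs)₂,₃ quantum fields in a finite volume. I. A lower bound*,
Commun. Math. Phys. **85** (1982) 603–626 [Balaban1982Higgs1]: the last display (3.69) p. 625 — the Gaussian
normalisations `Z_K Z_K(0)` of (3.31)–(3.32) against the free normalisation `exp(E₀)` of (1.12) — PROVED as the
determinant ratio it is, with the determinant–trace inequality for the (non-symmetric) operator `P_KG^ε` and the
resulting explicit form of the `O(1)|T_ε|` of r12's typed (3.68)–(3.69) shape `B1Sect3Statements.Ineq368`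

statement-level skeleton of published theorems with citation tags; proofs where landed; nothing here is a claim about the Yang–Mills mass gap

PDF held: `paper:balaban1982-cmp85-higgs23-i` (journal page = PDF page + 602); displays read on the x2 renders
`run/shared/lean/pub/pub-balaban/b2b-balaban-ref1/pages/1982-cmp85-higgs23-I/1982-cmp85-higgs23-I-p023-x2.png` (p. 625),
`…-p004-x2.png` (p. 606, (1.12)), `…-p008-x2.png` (p. 610, (2.20)), `…-p015-x2.png` (p. 617, (3.31)–(3.32)), READ AS IMAGES.

CITATION HEADER (lean-in-tree rule).  WHAT IS REPRODUCED, verbatim, p. 625 [PDF 23]: *"We get Z^ε ≧ Z_KZ_K(0) exp(−E₀ +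
O(1)|T_ε|). (3.68) It is easily seen that Z_KZ_K(0) is almost equal exp(E₀), more exactly we have
Z_KZ_K(0) exp(−E₀) = [det(I + a_K(L^Kε)^{d−2}P_KG^ε)]^{−1/2}·[det(I + a_K(L^Kε)^{d−2}P_KG^ε(0))]^{−1/2} exp(O(1)|T_ε|)
≧ exp[−½a_K(L^Kε)^{d−2}(Tr P_KG^ε + Tr P_KG^ε(0)) + O(1)|T_ε|] = exp(O(1)|T_ε|), (3.69) and we obtain finally the required
lower bound."* with p. 625 *"a constant O(1) which in general depends on L^Kε, thus on ε₀"*; (1.12) p. 606: *"∫dA exp(−½⟨A,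
(−Δ^ε + μ₀²)A⟩)∫dφ exp(−½⟨φ, (−Δ^ε_0 + m²)φ⟩) = exp(E₀,v)exp(E₀,s) = exp(E₀). (1.12)"*; (2.20) p. 610: *"G^ε_k(Ω, A) =
(−Δ^{ε,N}_{A,Ω} + m² + a_k(L^kε)^{−2}P_k(A))^{−1}, P_k(A) = Q_k^*(A)Q_k(A), (2.20)"* — SKELETON row **B1.Eq3.68-3.69**
(reader r12, `lit-balaban-r12/ROWS-B1-part2.md`: typed p239973 as the SHAPE `B1Sect3Statements.Ineq368` with two `O(1)`
constants as data + `Ineq369`/`ineq369_of_posSemidef`, the det–trace inequality for ONE SYMMETRIC positive semidefinite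
`X`, + `lowerBound_of_368`).  Phase-2 seat p12 (gen 2), TAKING line HOME/STATUS.md 2026-08-21T01:50Z; the sequel of the
seat's `B1GaussNorm331` (row B1.Eq3.31-3.32) and `B1GaussNorm339` (row B1.Eq3.39-3.40).

THE READING.  The three Gaussian objects of (3.69) are THE TREE'S: `Z_K` = (3.31) = `B1GaussNorm339.Zeps d nc a_K ℓ ε M_K`
and `Z_K(0)` = (3.32) at `A^{(K),ε} = 0` = `ZAeps d N nc a_K ℓ ε M_K'` (two-lattice reading: `nc = |T₁^{(K)}|` coarse sites,
fine sites `T`, `|T| = |T₁| = |T_ε|`, `ℓ = L^Kε`, `ε`-pairing (1.5)), and `exp(E₀)` = (1.12) = the product of the two FREE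
fluctuation integrals `gaussInt ε d M₀ · gaussInt ε d M₀'` (`E0` below; concrete model: `HiggsLattice.freeNormalization`),
where — as in those files, cell DIVERGENCE D-b01.3 — the operators enter through their matrices in the site/component
coordinates: `M₀` ↤ `−Δ^ε + μ₀²` (vector), `M₀'` ↤ `−Δ^ε_0 + m²` (scalar), and by (2.20) the fluctuation operators of
(3.31)/(3.32) are `M_K = M₀ + R`, `M_K' = M₀' + R'` with `R` ↤ `a_K(L^Kε)^{−2}P_K`, `R'` ↤ `a_K(L^Kε)^{−2}P_K(0)` POSITIVE
SEMIDEFINITE (`P_K = Q_K^*Q_K`).  The printed operator *"a_K(L^Kε)^{d−2}P_KG^ε"* is then `R * M₀⁻¹` (`G^ε = M₀⁻¹`); this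
file takes `R` abstract and makes no claim on the printed exponent `d − 2` (where (2.20) has `−2`; reading note for the
owners r12/r01 in HOME/STATUS.md).

WHAT THIS FILE PROVES (kernel-checked, 0 `sorry`, standard axioms):
* §1 `det_add_eq_det_one_add_mul_inv_mul` (`det(M₀ + R) = det(I + RM₀⁻¹)·det M₀`, `M₀ ≻ 0`) and **`ineq369_mul_inv`**:
  `B1Sect3Statements.Ineq369 (R * M₀⁻¹)` — the det–trace inequality `det(I + RG)^{−1/2} ≥ exp(−½Tr RG)` for the
  NON-symmetric `RG` (*"the operators … are positive and symmetric"* — in the `G`-metric: `RG` is similar to the positive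
  semidefinite `(B⁻¹)ᵀRB⁻¹`, `M₀ = BᵀB`, to which r12's `ineq369_of_posSemidef` applies BY NAME; Mathlib
  `det_one_add_mul_comm`, `trace_mul_comm`).
* §2 **`gaussInt_add_eq`**: `∫e^{−½⟨A,(M₀+R)A⟩_ε}dA = (∫e^{−½⟨A,M₀A⟩_ε}dA)·det(I + RM₀⁻¹)^{−1/2}` — a Gaussian ratio is a
  determinant ratio (the `(2π/ε^d)`-powers of `B1GaussNorm339.gaussInt_eq` cancel); `gaussInt_pos`.
* §3 `E0` = (1.12) (`exp_E0`) and **`eq369`**: (3.69) FIRST EQUALITY, EXACT: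
  `Z_KZ_K(0)e^{−E₀} = (a_Kℓ^{d−2}/2π)^{(d/2)|T₁^{(K)}|}(a_Kℓ^{d−2}/2π)^{(N/2)|T₁^{(K)}|}·det(I + RM₀⁻¹)^{−1/2}·det(I + R'M₀'⁻¹)^{−1/2}`
  (the print's `exp(O(1)|T_ε|)` is, at this line, exactly the prefactor of (3.31)–(3.32)); **`ineq369_chain`**: (3.69)
  INEQUALITY `… ≥ (prefactor)·exp(−½(Tr RM₀⁻¹ + Tr R'M₀'⁻¹))`; **`ineq368_right`**: the SECOND CONJUNCT of r12's `Ineq368`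
  for these objects with the EXPLICIT constant `C₂ = ((d+N)/2)|log(a_Kℓ^{d−2}/2π)| + C₃/2`, under the two displayed inputs
  `|T₁^{(K)}| ≤ |T_ε|` and `Tr RM₀⁻¹ + Tr R'M₀'⁻¹ ≤ C₃|T_ε|` (the print's *"= exp(O(1)|T_ε|)"*; `C₃` ↤
  `a_K(L^Kε)^{…}(d‖G^ε‖ + N‖G^ε(0)‖)`, not derived here), and **`ineq368_of_368`**: with (3.68) as the remaining hypothesis,
  r12's `Ineq368` for these objects — whence (`B1Sect3Statements.lowerBound_of_368`) the lower bound
  `Z^ε ≥ exp(−(C₁+C₂)|T_ε|)` of the Theorem (1.14) (`lowerBound_of_368'`).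
HONEST SCOPE.  (3.68) itself (the whole inductive lower bound of Sect. 3) is NOT proved here — it stays the hypothesis
`h368`; the operators are arguments (not constructed); the trace bound is a displayed hypothesis.  Unit
`lit-balaban-p12-g2` (Phase-2 seat p12, gen 2), HOME `run/shared/lean/pub/lit-balaban/` (seat log `lit-balaban-p12/STATUS.md`).
v1.1 (append-only, same seat; no v1 declaration changed): §4 — the trace input of *"= exp(O(1)|T_ε|)"* made EXPLICIT from
the two printed-level facts behind p. 625 *"The quadratic forms in the exponential above are bounded … with a constant O(1)
which in general depends on L^Kε"*: `trace_mul_le_of_le` (`Tr RG ≤ c·Tr R` for `R ⪰ 0`, `G ≼ c·I` — the propagator bounds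
`G^ε ≤ μ₀⁻²`, `G^ε(0) ≤ m⁻²` of (2.20)), `trace_adj_mul_eq_card` (`Tr Q^*Q = |coarse index set|` when `QQ^* = I`: block
averaging is a co-isometry, so `Tr P_K = d|T₁^{(K)}|` resp. `N|T₁^{(K)}|`), and **`ineq368_right_explicit`**: the second
conjunct of `Ineq368` for `R = a·Q^*Q`, `R' = a·Q'^*Q'` (`a` ↤ `a_K(L^Kε)^{−2}`) with the fully explicit constant
`C₂ = ((d+N)/2)|log(a_Kℓ^{d−2}/2π)| + a(c_A d + c_φ N)/2`.
v1.2 (append-only, same seat): §5 — the propagator bound itself from the PRIMAL form of (1.12)/(2.20) (`M₀ = −Δ^ε + μ₀²`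
with `−Δ^ε ⪰ 0`, i.e. `M₀ ≽ μ₀²I`): `posSemidef_inv_smul_one_sub_inv` (`M ≽ μI`, `μ > 0`, `M ≻ 0` ⟹ `M⁻¹ ≼ μ⁻¹I`,
elementary: `μ⁻¹I − M⁻¹ = M⁻¹·μ⁻¹[(M − μI)² + μ(M − μI)]·M⁻¹`, no spectral theory) and **`ineq368_right_explicit'`**
(`C₂ = ((d+N)/2)|log(a_Kℓ^{d−2}/2π)| + a(μ₀⁻²d + m⁻²N)/2` under `M₀ ≽ μ₀²I`, `M₀' ≽ m²I`).
-/

noncomputable section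

open MeasureTheory Matrix Finset
open scoped Real

namespace Literature.MathematicalPhysics.QuantumFieldTheory.Balaban1983to89.B1Eq369GaussRatio

open Literature.MathematicalPhysics.QuantumFieldTheory.Balaban1983to89
open B1GaussNorm339

/-! ## §1 Determinant and trace of `RG`, `G = M₀⁻¹`: the operator of (3.69) -/

section LinAlg

open scoped MatrixOrder ComplexOrder

variable {ι : Type*} [Fintype ι] [DecidableEq ι]

/-- `det(M₀ + R) = det(I + RM₀⁻¹)·det M₀` for `M₀` positive definite (so invertible): the determinant of the fluctuation
operator `(G^ε_K)⁻¹ = (G^ε)⁻¹ + R` of (2.20)/(3.31) against the free one `(G^ε)⁻¹`. [cite: Balaban1982Higgs1, (3.69) p.625] -/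
theorem det_add_eq_det_one_add_mul_inv_mul (M₀ R : Matrix ι ι ℝ) (hM : M₀.PosDef) :
    (M₀ + R).det = (1 + R * M₀⁻¹).det * M₀.det := by
  have hu : IsUnit M₀.det := isUnit_iff_ne_zero.2 hM.det_pos.ne'
  rw [← det_mul, add_mul, one_mul, mul_assoc, nonsing_inv_mul _ hu, mul_one]

/-- `det(I + RM₀⁻¹) > 0` for `M₀ ≻ 0`, `R ⪰ 0` (it is `det(M₀ + R)/det M₀`). [cite: Balaban1982Higgs1, (3.69) p.625] -/
theorem det_one_add_mul_inv_pos {M₀ R : Matrix ι ι ℝ} (hM : M₀.PosDef) (hR : R.PosSemidef) :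
    0 < (1 + R * M₀⁻¹).det := by
  have h := (hM.add_posSemidef hR).det_pos
  rw [det_add_eq_det_one_add_mul_inv_mul M₀ R hM] at h
  exact (mul_pos_iff_of_pos_right hM.det_pos).mp h

/-- **the determinant–trace inequality of (3.69) for the printed operator** `X = a_K(L^Kε)^{…}P_KG^ε = RG` (`G = M₀⁻¹`,
`M₀ ≻ 0`, `R ⪰ 0`): `det(I + RG)^{−1/2} ≥ exp(−½Tr RG)`, i.e. `B1Sect3Statements.Ineq369 (R * M₀⁻¹)`.  `RG` is not a
symmetric matrix, but (*"obviously the operators standing in the above determinants are positive and symmetric"*, p. 620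
— with respect to the scalar product defined by `G`) it is SIMILAR to the positive semidefinite `(B⁻¹)ᵀRB⁻¹` where
`M₀ = BᵀB`: `det(I + RB⁻¹(B⁻¹)ᵀ) = det(I + (B⁻¹)ᵀRB⁻¹)`, `Tr` likewise; then r12's `ineq369_of_posSemidef` BY NAME.
[cite: Balaban1982Higgs1, (3.69) p.625] -/
theorem ineq369_mul_inv {M₀ R : Matrix ι ι ℝ} (hM : M₀.PosDef) (hR : R.PosSemidef) :
    B1Sect3Statements.Ineq369 (R * M₀⁻¹) := by
  -- `M₀ = BᵀB` with `det B ≠ 0` (positive ⇒ `star B * B` in the C⋆-order on real matrices, as in `Beta.GaussianIntegral`)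
  obtain ⟨B, hB⟩ : ∃ B : Matrix ι ι ℝ, M₀ = Bᵀ * B := by
    obtain ⟨B, hB⟩ := CStarAlgebra.nonneg_iff_eq_star_mul_self.mp hM.posSemidef.nonneg
    exact ⟨B, by rwa [Matrix.star_eq_conjTranspose, Matrix.conjTranspose_eq_transpose_of_trivial] at hB⟩
  have hinv : M₀⁻¹ = B⁻¹ * (B⁻¹)ᵀ := by
    rw [hB, Matrix.mul_inv_rev, Matrix.transpose_nonsing_inv]
  -- the similar positive semidefinite matrix
  have hX : ((B⁻¹)ᵀ * R * B⁻¹).PosSemidef := by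
    have h := hR.conjTranspose_mul_mul_same B⁻¹
    rwa [Matrix.conjTranspose_eq_transpose_of_trivial] at h
  have hdet : (1 + R * M₀⁻¹).det = (1 + (B⁻¹)ᵀ * R * B⁻¹).det := by
    rw [hinv, ← mul_assoc, det_one_add_mul_comm, ← mul_assoc]
  have htr : (R * M₀⁻¹).trace = ((B⁻¹)ᵀ * R * B⁻¹).trace := by
    rw [hinv, ← mul_assoc, trace_mul_comm, ← mul_assoc]
  unfold B1Sect3Statements.Ineq369
  rw [hdet, htr]
  exact B1Sect3Statements.ineq369_of_posSemidef hX

end LinAlg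

/-! ## §2 A ratio of Gaussian fluctuation integrals is a determinant ratio -/

section Gauss

variable {ι : Type*} [Fintype ι] [DecidableEq ι]

/-- the Gaussian fluctuation integral is positive (`η > 0`, `M ≻ 0`). [cite: Balaban1982Higgs1, (1.12) p.606] -/
theorem gaussInt_pos {η : ℝ} (hη : 0 < η) (d : ℕ) {M : Matrix ι ι ℝ} (hM : M.PosDef) : 0 < gaussInt η d M := by
  rw [gaussInt_eq hη d hM]
  exact div_pos (Real.rpow_pos_of_pos (div_pos (by positivity) (pow_pos hη d)) _) (Real.sqrt_pos.2 hM.det_pos)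

/-- **Gaussian ratio = determinant ratio**: for `ε > 0`, `M₀ ≻ 0`, `R ⪰ 0`,
`∫dA e^{−½⟨A,(M₀+R)A⟩_ε} = (∫dA e^{−½⟨A,M₀A⟩_ε})·det(I + RM₀⁻¹)^{−1/2}` — the two `(2π/ε^d)^{|ι|/2}` cancel; this is the
computation behind *"Z_KZ_K(0) is almost equal exp(E₀)"*. [cite: Balaban1982Higgs1, (3.69) p.625] -/
theorem gaussInt_add_eq {ε : ℝ} (hε : 0 < ε) (d : ℕ) {M₀ R : Matrix ι ι ℝ} (hM : M₀.PosDef) (hR : R.PosSemidef) :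
    gaussInt ε d (M₀ + R) = gaussInt ε d M₀ * (1 + R * M₀⁻¹).det ^ (-(1 / 2 : ℝ)) := by
  have hMR : (M₀ + R).PosDef := hM.add_posSemidef hR
  have h1 : 0 < (1 + R * M₀⁻¹).det := det_one_add_mul_inv_pos hM hR
  have hs1 : 0 < Real.sqrt (1 + R * M₀⁻¹).det := Real.sqrt_pos.2 h1
  have hs0 : 0 < Real.sqrt M₀.det := Real.sqrt_pos.2 hM.det_pos
  have e : (1 + R * M₀⁻¹).det ^ (-(1 / 2 : ℝ)) = (Real.sqrt (1 + R * M₀⁻¹).det)⁻¹ := by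
    rw [Real.sqrt_eq_rpow, Real.rpow_neg h1.le]
  rw [gaussInt_eq hε d hMR, gaussInt_eq hε d hM, det_add_eq_det_one_add_mul_inv_mul M₀ R hM,
    Real.sqrt_mul h1.le, e]
  field_simp

end Gauss

/-! ## §3 (1.12) `E₀` and the display (3.69) for the normalisations (3.31)/(3.32) -/

section Printed

variable {T : Type*} [Fintype T] [DecidableEq T]

/-- **(1.12)** p. 606: *"∫dA exp(−½⟨A, (−Δ^ε + μ₀²)A⟩)∫dφ exp(−½⟨φ, (−Δ^ε_0 + m²)φ⟩) = exp(E₀,v)exp(E₀,s) = exp(E₀)"* —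
`E₀ = E₀,v + E₀,s`, the logarithms of the two free fluctuation integrals on the fine lattice (`ε`-pairing; `M₀`, `M₀'`
the matrices of `−Δ^ε + μ₀²`, `−Δ^ε_0 + m²`; concrete model: `HiggsLattice.freeNormalization`).
[cite: Balaban1982Higgs1, (1.12) p.606] -/
def E0 (d N : ℕ) (ε : ℝ) (M₀ : Matrix (T × Fin d) (T × Fin d) ℝ) (M₀' : Matrix (T × Fin N) (T × Fin N) ℝ) : ℝ :=
  Real.log (gaussInt ε d M₀) + Real.log (gaussInt ε d M₀')

/-- (1.12) in its printed shape: `∫dA e^{…} ∫dφ e^{…} = exp(E₀)` (`ε > 0`, free operators positive definite).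
[cite: Balaban1982Higgs1, (1.12) p.606] -/
theorem exp_E0 (d N : ℕ) {ε : ℝ} (hε : 0 < ε) {M₀ : Matrix (T × Fin d) (T × Fin d) ℝ} (hM : M₀.PosDef)
    {M₀' : Matrix (T × Fin N) (T × Fin N) ℝ} (hM' : M₀'.PosDef) :
    gaussInt ε d M₀ * gaussInt ε d M₀' = Real.exp (E0 d N ε M₀ M₀') := by
  rw [E0, Real.exp_add, Real.exp_log (gaussInt_pos hε d hM), Real.exp_log (gaussInt_pos hε d hM')]

/-- **(3.69), first equality — EXACT**: with `Z_K` = (3.31) for `(G^ε_K)⁻¹ = M₀ + R`, `Z_K(0)` = (3.32) for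
`(G^ε_K(0))⁻¹ = M₀' + R'` and `E₀` = (1.12):
`Z_KZ_K(0)e^{−E₀} = (a_Kℓ^{d−2}/2π)^{(d/2)|T₁^{(K)}|}(a_Kℓ^{d−2}/2π)^{(N/2)|T₁^{(K)}|}·det(I + RM₀⁻¹)^{−1/2}·det(I + R'M₀'⁻¹)^{−1/2}`
— the print's `[det(I + a_K(L^Kε)^{…}P_KG^ε)]^{−1/2}[det(I + …G^ε(0))]^{−1/2} exp(O(1)|T_ε|)` with the `O(1)|T_ε|` made
explicit as the logarithm of the (3.31)–(3.32) prefactors. [cite: Balaban1982Higgs1, (3.69) p.625] -/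
theorem eq369 (d N nc : ℕ) (aK ℓ : ℝ) {ε : ℝ} (hε : 0 < ε)
    {M₀ R : Matrix (T × Fin d) (T × Fin d) ℝ} (hM : M₀.PosDef) (hR : R.PosSemidef)
    {M₀' R' : Matrix (T × Fin N) (T × Fin N) ℝ} (hM' : M₀'.PosDef) (hR' : R'.PosSemidef) :
    Zeps d nc aK ℓ ε (M₀ + R) * ZAeps d N nc aK ℓ ε (M₀' + R') * Real.exp (-E0 d N ε M₀ M₀')
      = (B1RT.prec aK ℓ d / (2 * π)) ^ ((d : ℝ) / 2 * (nc : ℝ))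
        * (B1RT.prec aK ℓ d / (2 * π)) ^ ((N : ℝ) / 2 * (nc : ℝ))
        * (1 + R * M₀⁻¹).det ^ (-(1 / 2 : ℝ)) * (1 + R' * M₀'⁻¹).det ^ (-(1 / 2 : ℝ)) := by
  have h0 : 0 < gaussInt ε d M₀ := gaussInt_pos hε d hM
  have h0' : 0 < gaussInt ε d M₀' := gaussInt_pos hε d hM'
  rw [Zeps, ZAeps, gaussInt_add_eq hε d hM hR, gaussInt_add_eq hε d hM' hR', Real.exp_neg, ← exp_E0 d N hε hM hM']
  field_simp

/-- **(3.69), the inequality**: `Z_KZ_K(0)e^{−E₀} ≥ (prefactors)·exp[−½(Tr RM₀⁻¹ + Tr R'M₀'⁻¹)]` — the print's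
`≧ exp[−½a_K(L^Kε)^{…}(Tr P_KG^ε + Tr P_KG^ε(0)) + O(1)|T_ε|]`, from `eq369` and the det–trace inequality
`ineq369_mul_inv` for both factors. [cite: Balaban1982Higgs1, (3.69) p.625] -/
theorem ineq369_chain (d N nc : ℕ) {aK ℓ ε : ℝ} (hak : 0 < aK) (hℓ : 0 < ℓ) (hε : 0 < ε)
    {M₀ R : Matrix (T × Fin d) (T × Fin d) ℝ} (hM : M₀.PosDef) (hR : R.PosSemidef)
    {M₀' R' : Matrix (T × Fin N) (T × Fin N) ℝ} (hM' : M₀'.PosDef) (hR' : R'.PosSemidef) :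
    (B1RT.prec aK ℓ d / (2 * π)) ^ ((d : ℝ) / 2 * (nc : ℝ))
        * (B1RT.prec aK ℓ d / (2 * π)) ^ ((N : ℝ) / 2 * (nc : ℝ))
        * Real.exp (-(1 / 2) * ((R * M₀⁻¹).trace + (R' * M₀'⁻¹).trace))
      ≤ Zeps d nc aK ℓ ε (M₀ + R) * ZAeps d N nc aK ℓ ε (M₀' + R') * Real.exp (-E0 d N ε M₀ M₀') := by
  rw [eq369 d N nc aK ℓ hε hM hR hM' hR']
  have hq : 0 < B1RT.prec aK ℓ d / (2 * π) := div_pos (B1RT.prec_pos hak hℓ d) (by positivity)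
  have hP : 0 ≤ (B1RT.prec aK ℓ d / (2 * π)) ^ ((d : ℝ) / 2 * (nc : ℝ))
      * (B1RT.prec aK ℓ d / (2 * π)) ^ ((N : ℝ) / 2 * (nc : ℝ)) :=
    mul_nonneg (Real.rpow_pos_of_pos hq _).le (Real.rpow_pos_of_pos hq _).le
  have h1 := ineq369_mul_inv hM hR
  have h2 := ineq369_mul_inv hM' hR'
  unfold B1Sect3Statements.Ineq369 at h1 h2
  have hexp : Real.exp (-(1 / 2) * ((R * M₀⁻¹).trace + (R' * M₀'⁻¹).trace))
      = Real.exp (-(1 / 2) * (R * M₀⁻¹).trace) * Real.exp (-(1 / 2) * (R' * M₀'⁻¹).trace) := by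
    rw [← Real.exp_add]; ring_nf
  rw [hexp, mul_assoc ((B1RT.prec aK ℓ d / (2 * π)) ^ ((d : ℝ) / 2 * (nc : ℝ))
    * (B1RT.prec aK ℓ d / (2 * π)) ^ ((N : ℝ) / 2 * (nc : ℝ)))]
  exact mul_le_mul_of_nonneg_left (mul_le_mul h1 h2 (Real.exp_pos _).le
    (Real.rpow_pos_of_pos (det_one_add_mul_inv_pos hM hR) _).le) hP

/-- **(3.69) ⇒ the second conjunct of (3.68)–(3.69) as typed by r12** (`B1Sect3Statements.Ineq368`, shape
`Z_KZ_K(0)e^{−E₀} ≥ exp(−C₂|T_ε|)`) for THESE normalisations, with the EXPLICIT constant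
`C₂ = ((d+N)/2)|log(a_Kℓ^{d−2}/2π)| + C₃/2` (*"a constant O(1) which in general depends on L^Kε"*), under the two inputs
the print uses for *"= exp(O(1)|T_ε|)"*: `|T₁^{(K)}| ≤ |T_ε|` (`hnc`) and the trace bound
`Tr RM₀⁻¹ + Tr R'M₀'⁻¹ ≤ C₃|T_ε|` (`htr`). [cite: Balaban1982Higgs1, (3.68)–(3.69) p.625] -/
theorem ineq368_right (d N nc : ℕ) {aK ℓ ε : ℝ} (hak : 0 < aK) (hℓ : 0 < ℓ) (hε : 0 < ε)
    {M₀ R : Matrix (T × Fin d) (T × Fin d) ℝ} (hM : M₀.PosDef) (hR : R.PosSemidef)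
    {M₀' R' : Matrix (T × Fin N) (T × Fin N) ℝ} (hM' : M₀'.PosDef) (hR' : R'.PosSemidef)
    {vol C₃ : ℝ} (hnc : (nc : ℝ) ≤ vol) (htr : (R * M₀⁻¹).trace + (R' * M₀'⁻¹).trace ≤ C₃ * vol) :
    Zeps d nc aK ℓ ε (M₀ + R) * ZAeps d N nc aK ℓ ε (M₀' + R') * Real.exp (-E0 d N ε M₀ M₀')
      ≥ Real.exp (-((((d : ℝ) + N) / 2 * |Real.log (B1RT.prec aK ℓ d / (2 * π))| + C₃ / 2) * vol)) := by
  refine le_trans ?_ (ineq369_chain d N nc hak hℓ hε hM hR hM' hR')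
  set q : ℝ := B1RT.prec aK ℓ d / (2 * π) with hq_def
  have hq : 0 < q := div_pos (B1RT.prec_pos hak hℓ d) (by positivity)
  -- the prefactors as one exponential
  have hpref : q ^ ((d : ℝ) / 2 * (nc : ℝ)) * q ^ ((N : ℝ) / 2 * (nc : ℝ))
      = Real.exp (((d : ℝ) + N) / 2 * (nc : ℝ) * Real.log q) := by
    rw [← Real.rpow_add hq, Real.rpow_def_of_pos hq]
    congr 1
    ring
  rw [hpref, ← Real.exp_add, Real.exp_le_exp]
  -- compare the exponents: −((d+N)/2·|log q| + C₃/2)·vol ≤ ((d+N)/2)·nc·log q − ½(Tr + Tr')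
  have hnc0 : (0 : ℝ) ≤ nc := Nat.cast_nonneg nc
  have hdN : (0 : ℝ) ≤ ((d : ℝ) + N) / 2 := by positivity
  have h1 : -( ((d : ℝ) + N) / 2 * |Real.log q| * vol) ≤ ((d : ℝ) + N) / 2 * (nc : ℝ) * Real.log q := by
    have ha : -( |Real.log q| * vol) ≤ (nc : ℝ) * Real.log q := by
      have hlo : -(|Real.log q|) ≤ Real.log q := neg_abs_le _
      have hvol : (nc : ℝ) * |Real.log q| ≤ vol * |Real.log q| :=
        mul_le_mul_of_nonneg_right hnc (abs_nonneg _)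
      nlinarith [hlo, hvol, abs_nonneg (Real.log q)]
    have := mul_le_mul_of_nonneg_left ha hdN
    linarith [this]
  have h2 : -(C₃ / 2 * vol) ≤ -(1 / 2) * ((R * M₀⁻¹).trace + (R' * M₀'⁻¹).trace) := by linarith
  linarith [h1, h2]

/-- **(3.68)–(3.69) as typed** (`B1Sect3Statements.Ineq368 Z Z_K Z_K(0) E₀ C₁ C₂ |T_ε|`) for these normalisations: given the
inductive lower bound (3.68) `Z^ε ≥ Z_KZ_K(0)exp(−E₀ − C₁|T_ε|)` (hypothesis `h368` — the content of the whole of Sect. 3,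
not proved here), the second conjunct is `ineq368_right`. [cite: Balaban1982Higgs1, (3.68)–(3.69) p.625] -/
theorem ineq368_of_368 (d N nc : ℕ) {aK ℓ ε : ℝ} (hak : 0 < aK) (hℓ : 0 < ℓ) (hε : 0 < ε)
    {M₀ R : Matrix (T × Fin d) (T × Fin d) ℝ} (hM : M₀.PosDef) (hR : R.PosSemidef)
    {M₀' R' : Matrix (T × Fin N) (T × Fin N) ℝ} (hM' : M₀'.PosDef) (hR' : R'.PosSemidef)
    {vol C₃ : ℝ} (hnc : (nc : ℝ) ≤ vol) (htr : (R * M₀⁻¹).trace + (R' * M₀'⁻¹).trace ≤ C₃ * vol)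
    {Z C₁ : ℝ} (h368 : Z ≥ Zeps d nc aK ℓ ε (M₀ + R) * ZAeps d N nc aK ℓ ε (M₀' + R')
      * Real.exp (-E0 d N ε M₀ M₀' - C₁ * vol)) :
    B1Sect3Statements.Ineq368 Z (Zeps d nc aK ℓ ε (M₀ + R)) (ZAeps d N nc aK ℓ ε (M₀' + R')) (E0 d N ε M₀ M₀') C₁
      (((d : ℝ) + N) / 2 * |Real.log (B1RT.prec aK ℓ d / (2 * π))| + C₃ / 2) vol := by
  refine ⟨h368, ?_⟩
  have h := ineq368_right d N nc hak hℓ hε hM hR hM' hR' hnc htr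
  rwa [neg_mul]

/-- … whence the LOWER BOUND OF THE THEOREM (1.14) in the form p. 625 draws it, `Z^ε ≥ exp(−(C₁ + C₂)|T_ε|)`, by r12's
`B1Sect3Statements.lowerBound_of_368` BY NAME (given (3.68)). [cite: Balaban1982Higgs1, (3.68)–(3.69) p.625] -/
theorem lowerBound_of_368' (d N nc : ℕ) {aK ℓ ε : ℝ} (hak : 0 < aK) (hℓ : 0 < ℓ) (hε : 0 < ε)
    {M₀ R : Matrix (T × Fin d) (T × Fin d) ℝ} (hM : M₀.PosDef) (hR : R.PosSemidef)
    {M₀' R' : Matrix (T × Fin N) (T × Fin N) ℝ} (hM' : M₀'.PosDef) (hR' : R'.PosSemidef)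
    {vol C₃ : ℝ} (hnc : (nc : ℝ) ≤ vol) (htr : (R * M₀⁻¹).trace + (R' * M₀'⁻¹).trace ≤ C₃ * vol)
    {Z C₁ : ℝ} (h368 : Z ≥ Zeps d nc aK ℓ ε (M₀ + R) * ZAeps d N nc aK ℓ ε (M₀' + R')
      * Real.exp (-E0 d N ε M₀ M₀' - C₁ * vol)) :
    Z ≥ Real.exp (-(C₁ + (((d : ℝ) + N) / 2 * |Real.log (B1RT.prec aK ℓ d / (2 * π))| + C₃ / 2)) * vol) :=
  B1Sect3Statements.lowerBound_of_368 (ineq368_of_368 d N nc hak hℓ hε hM hR hM' hR' hnc htr h368)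

end Printed

/-! ## §4 (v1.1, append-only) The trace input of (3.69) `… = exp(O(1)|T_ε|)` made explicit -/

section TraceInput

open scoped MatrixOrder ComplexOrder

variable {ι κ : Type*} [Fintype ι] [DecidableEq ι] [Fintype κ] [DecidableEq κ]

omit [Fintype κ] [DecidableEq κ] in
/-- `Tr(RG) ≤ c·Tr R` for `R ⪰ 0` and `G ≼ c·I` — the propagator bound (`G^ε ≤ μ₀⁻²`, `G^ε(0) ≤ m⁻²` from (2.20)) entering
p. 625 *"The quadratic forms in the exponential above are bounded"*; proof: `R = CᵀC`, `Tr(CᵀCG) = Tr(CGCᵀ) ≤ Tr(C(c·I)Cᵀ) =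
c·Tr R` by positivity of `C(c·I − G)Cᵀ`. [cite: Balaban1982Higgs1, (3.69) p.625] -/
theorem trace_mul_le_of_le {R G : Matrix ι ι ℝ} (hR : R.PosSemidef) {c : ℝ}
    (hG : (c • (1 : Matrix ι ι ℝ) - G).PosSemidef) : (R * G).trace ≤ c * R.trace := by
  obtain ⟨C, hC⟩ : ∃ C : Matrix ι ι ℝ, R = Cᵀ * C := by
    obtain ⟨C, hC⟩ := CStarAlgebra.nonneg_iff_eq_star_mul_self.mp hR.nonneg
    exact ⟨C, by rwa [Matrix.star_eq_conjTranspose, Matrix.conjTranspose_eq_transpose_of_trivial] at hC⟩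
  have h1 : (R * G).trace = (C * G * Cᵀ).trace := by
    rw [hC, mul_assoc, trace_mul_comm]
  have h2 : c * R.trace = (C * (c • (1 : Matrix ι ι ℝ)) * Cᵀ).trace := by
    rw [hC, trace_mul_comm, Matrix.mul_smul, Matrix.mul_one, Matrix.smul_mul, trace_smul, smul_eq_mul]
  have h3 : (C * (c • (1 : Matrix ι ι ℝ) - G) * Cᵀ).PosSemidef := by
    have h := hG.mul_mul_conjTranspose_same C
    rwa [Matrix.conjTranspose_eq_transpose_of_trivial] at h
  have h4 := h3.trace_nonneg
  rw [mul_sub, sub_mul, trace_sub] at h4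
  linarith [h1, h2, h4]

omit [DecidableEq ι] in
/-- `Tr(Q^*Q) = |κ|` when `QQ^* = I_κ` — block averaging (2.20) is a co-isometry (the average of a block-constant field is
that constant), so `P_K = Q_K^*Q_K` has `Tr P_K = d|T₁^{(K)}|` (vector) resp. `N|T₁^{(K)}|` (scalar): the volume factor of
p. 625's `O(1)|T_ε|`. [cite: Balaban1982Higgs1, (2.20) p.610] -/
theorem trace_adj_mul_eq_card (Q : Matrix κ ι ℝ) (Qadj : Matrix ι κ ℝ) (h : Q * Qadj = 1) :
    (Qadj * Q).trace = Fintype.card κ := by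
  rw [trace_mul_comm, h, trace_one]

end TraceInput

section Explicit

variable {T : Type*} [Fintype T] [DecidableEq T]

/-- **(3.69) `= exp(O(1)|T_ε|)` with a fully explicit `O(1)`**: for `R = a·Q^*Q`, `R' = a·Q'^*Q'` (`a` ↤ `a_K(L^Kε)^{−2}`,
`QQ^* = I`, `Q'Q'^* = I` on the coarse index sets `Tc × Fin d`, `Tc × Fin N`, `|Tc| = |T₁^{(K)}|`), `R, R' ⪰ 0`, the free
propagators bounded `G^ε = M₀⁻¹ ≼ c_A·I`, `G^ε(0) = M₀'⁻¹ ≼ c_φ·I` and `|T₁^{(K)}| ≤ |T_ε|`: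
`Z_KZ_K(0)e^{−E₀} ≥ exp(−C₂|T_ε|)`, `C₂ = ((d+N)/2)|log(a_Kℓ^{d−2}/2π)| + a(c_A d + c_φ N)/2` — the second conjunct of r12's
`Ineq368` with both `O(1)` inputs discharged (`ineq368_right` + `trace_mul_le_of_le` + `trace_adj_mul_eq_card`).
[cite: Balaban1982Higgs1, (3.68)–(3.69) p.625] -/
theorem ineq368_right_explicit (d N : ℕ) {Tc : Type*} [Fintype Tc] [DecidableEq Tc] {aK ℓ ε : ℝ} (hak : 0 < aK)
    (hℓ : 0 < ℓ)
    (hε : 0 < ε) {M₀ : Matrix (T × Fin d) (T × Fin d) ℝ} (hM : M₀.PosDef)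
    {M₀' : Matrix (T × Fin N) (T × Fin N) ℝ} (hM' : M₀'.PosDef)
    (Q : Matrix (Tc × Fin d) (T × Fin d) ℝ) (Qadj : Matrix (T × Fin d) (Tc × Fin d) ℝ) (hQ : Q * Qadj = 1)
    (Q' : Matrix (Tc × Fin N) (T × Fin N) ℝ) (Qadj' : Matrix (T × Fin N) (Tc × Fin N) ℝ) (hQ' : Q' * Qadj' = 1)
    {a : ℝ} (ha : 0 ≤ a) (hR : (a • (Qadj * Q)).PosSemidef) (hR' : (a • (Qadj' * Q')).PosSemidef)
    {cA cφ : ℝ} (hcA : 0 ≤ cA) (hcφ : 0 ≤ cφ)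
    (hG : (cA • (1 : Matrix (T × Fin d) (T × Fin d) ℝ) - M₀⁻¹).PosSemidef)
    (hG' : (cφ • (1 : Matrix (T × Fin N) (T × Fin N) ℝ) - M₀'⁻¹).PosSemidef)
    {vol : ℝ} (hnc : (Fintype.card Tc : ℝ) ≤ vol) :
    Zeps d (Fintype.card Tc) aK ℓ ε (M₀ + a • (Qadj * Q))
        * ZAeps d N (Fintype.card Tc) aK ℓ ε (M₀' + a • (Qadj' * Q')) * Real.exp (-E0 d N ε M₀ M₀')
      ≥ Real.exp (-((((d : ℝ) + N) / 2 * |Real.log (B1RT.prec aK ℓ d / (2 * π))|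
          + a * (cA * (d : ℝ) + cφ * (N : ℝ)) / 2) * vol)) := by
  apply ineq368_right d N (Fintype.card Tc) hak hℓ hε hM hR hM' hR' hnc
  -- the trace bound `Tr RG + Tr R'G' ≤ a(c_A d + c_φ N)|T₁^{(K)}| ≤ a(c_A d + c_φ N)|T_ε|`
  have e1 : (a • (Qadj * Q)).trace = a * ((Fintype.card Tc : ℝ) * d) := by
    rw [trace_smul, smul_eq_mul, trace_adj_mul_eq_card Q Qadj hQ, Fintype.card_prod, Fintype.card_fin]
    push_cast
    ring
  have e2 : (a • (Qadj' * Q')).trace = a * ((Fintype.card Tc : ℝ) * N) := by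
    rw [trace_smul, smul_eq_mul, trace_adj_mul_eq_card Q' Qadj' hQ', Fintype.card_prod, Fintype.card_fin]
    push_cast
    ring
  have h1 : (a • (Qadj * Q) * M₀⁻¹).trace ≤ cA * (a * ((Fintype.card Tc : ℝ) * d)) := by
    have h := trace_mul_le_of_le hR hG
    rwa [e1] at h
  have h2 : (a • (Qadj' * Q') * M₀'⁻¹).trace ≤ cφ * (a * ((Fintype.card Tc : ℝ) * N)) := by
    have h := trace_mul_le_of_le hR' hG'
    rwa [e2] at h
  have hk : 0 ≤ a * (cA * (d : ℝ) + cφ * (N : ℝ)) := by positivity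
  have hvol : a * (cA * (d : ℝ) + cφ * (N : ℝ)) * (Fintype.card Tc : ℝ) ≤ a * (cA * (d : ℝ) + cφ * (N : ℝ)) * vol :=
    mul_le_mul_of_nonneg_left hnc hk
  have eq : cA * (a * ((Fintype.card Tc : ℝ) * d)) + cφ * (a * ((Fintype.card Tc : ℝ) * N))
      = a * (cA * (d : ℝ) + cφ * (N : ℝ)) * (Fintype.card Tc : ℝ) := by ring
  linarith [h1, h2, hvol, eq]

end Explicit

/-! ## §5 (v1.2, append-only) The propagator bound `G ≤ μ₀⁻²` from `−Δ^ε ⪰ 0`, and (3.69) with primal hypotheses -/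

section InvBound

variable {ι : Type*} [Fintype ι] [DecidableEq ι]

/-- `M ≽ μI`, `μ > 0`, `M ≻ 0` ⟹ `M⁻¹ ≼ μ⁻¹I` — the propagator bound `G^ε = (−Δ^ε + μ₀²)⁻¹ ≤ μ₀⁻²` (resp.
`G^ε(0) = (−Δ^ε_0 + m²)⁻¹ ≤ m⁻²`) of (1.12)/(2.20) from `−Δ^ε ⪰ 0`; elementary proof by the congruence
`μ⁻¹I − M⁻¹ = M⁻¹·μ⁻¹[(M − μI)² + μ(M − μI)]·M⁻¹`. [cite: Balaban1982Higgs1, (2.20) p.610] -/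
theorem posSemidef_inv_smul_one_sub_inv {M : Matrix ι ι ℝ} (hM : M.PosDef) {μ : ℝ} (hμ : 0 < μ)
    (h : (M - μ • (1 : Matrix ι ι ℝ)).PosSemidef) : (μ⁻¹ • (1 : Matrix ι ι ℝ) - M⁻¹).PosSemidef := by
  have hu : IsUnit M.det := isUnit_iff_ne_zero.2 hM.det_pos.ne'
  have hH : Mᴴ = M := hM.isHermitian
  have hDt : (M - μ • (1 : Matrix ι ι ℝ))ᴴ = M - μ • 1 := h.isHermitian
  have hsq : ((M - μ • (1 : Matrix ι ι ℝ)) * (M - μ • 1)).PosSemidef := by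
    have h2 := posSemidef_conjTranspose_mul_self (M - μ • (1 : Matrix ι ι ℝ))
    rwa [hDt] at h2
  have e1 : (M - μ • (1 : Matrix ι ι ℝ)) * (M - μ • 1) + μ • (M - μ • 1) = M * M - μ • M := by
    rw [show μ • (M - μ • (1 : Matrix ι ι ℝ)) = (μ • (1 : Matrix ι ι ℝ)) * (M - μ • 1) by
      rw [Matrix.smul_mul, Matrix.one_mul], ← add_mul, sub_add_cancel, mul_sub, Matrix.mul_smul, Matrix.mul_one]
  have hX : (μ⁻¹ • (M * M - μ • M)).PosSemidef := by
    rw [← e1]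
    exact (hsq.add (h.smul hμ.le)).smul (inv_nonneg.mpr hμ.le)
  have hc := hX.mul_mul_conjTranspose_same M⁻¹
  rw [conjTranspose_nonsing_inv, hH] at hc
  have e2 : M⁻¹ * (μ⁻¹ • (M * M - μ • M)) * M⁻¹ = μ⁻¹ • (1 : Matrix ι ι ℝ) - M⁻¹ := by
    rw [Matrix.mul_smul, Matrix.smul_mul, mul_sub, ← mul_assoc, nonsing_inv_mul _ hu, one_mul, Matrix.mul_smul,
      nonsing_inv_mul _ hu, sub_mul, mul_nonsing_inv _ hu, Matrix.smul_mul, one_mul, smul_sub, smul_smul,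
      inv_mul_cancel₀ hμ.ne', one_smul]
  rwa [e2] at hc

end InvBound

section ExplicitPrimal

variable {T : Type*} [Fintype T] [DecidableEq T]

/-- **(3.69) `= exp(O(1)|T_ε|)`, explicit, with PRIMAL hypotheses**: as `ineq368_right_explicit` but with the propagator
bounds DERIVED from `M₀ ≽ μI` (`M₀ = −Δ^ε + μ₀²`, `−Δ^ε ⪰ 0`, `μ = μ₀²`) and `M₀' ≽ μ'I` (`μ' = m²`):
`Z_KZ_K(0)e^{−E₀} ≥ exp(−C₂|T_ε|)`, `C₂ = ((d+N)/2)|log(a_Kℓ^{d−2}/2π)| + a(μ⁻¹d + μ'⁻¹N)/2`.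
[cite: Balaban1982Higgs1, (3.68)–(3.69) p.625] -/
theorem ineq368_right_explicit' (d N : ℕ) {Tc : Type*} [Fintype Tc] [DecidableEq Tc] {aK ℓ ε : ℝ} (hak : 0 < aK)
    (hℓ : 0 < ℓ) (hε : 0 < ε) {M₀ : Matrix (T × Fin d) (T × Fin d) ℝ} (hM : M₀.PosDef)
    {M₀' : Matrix (T × Fin N) (T × Fin N) ℝ} (hM' : M₀'.PosDef)
    (Q : Matrix (Tc × Fin d) (T × Fin d) ℝ) (Qadj : Matrix (T × Fin d) (Tc × Fin d) ℝ) (hQ : Q * Qadj = 1)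
    (Q' : Matrix (Tc × Fin N) (T × Fin N) ℝ) (Qadj' : Matrix (T × Fin N) (Tc × Fin N) ℝ) (hQ' : Q' * Qadj' = 1)
    {a : ℝ} (ha : 0 ≤ a) (hR : (a • (Qadj * Q)).PosSemidef) (hR' : (a • (Qadj' * Q')).PosSemidef)
    {μ μ' : ℝ} (hμ : 0 < μ) (hμ' : 0 < μ')
    (hΔ : (M₀ - μ • (1 : Matrix (T × Fin d) (T × Fin d) ℝ)).PosSemidef)
    (hΔ' : (M₀' - μ' • (1 : Matrix (T × Fin N) (T × Fin N) ℝ)).PosSemidef)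
    {vol : ℝ} (hnc : (Fintype.card Tc : ℝ) ≤ vol) :
    Zeps d (Fintype.card Tc) aK ℓ ε (M₀ + a • (Qadj * Q))
        * ZAeps d N (Fintype.card Tc) aK ℓ ε (M₀' + a • (Qadj' * Q')) * Real.exp (-E0 d N ε M₀ M₀')
      ≥ Real.exp (-((((d : ℝ) + N) / 2 * |Real.log (B1RT.prec aK ℓ d / (2 * π))|
          + a * (μ⁻¹ * (d : ℝ) + μ'⁻¹ * (N : ℝ)) / 2) * vol)) :=
  ineq368_right_explicit d N hak hℓ hε hM hM' Q Qadj hQ Q' Qadj' hQ' ha hR hR' (inv_nonneg.mpr hμ.le)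
    (inv_nonneg.mpr hμ'.le) (posSemidef_inv_smul_one_sub_inv hM hμ hΔ)
    (posSemidef_inv_smul_one_sub_inv hM' hμ' hΔ') hnc

end ExplicitPrimal

end Literature.MathematicalPhysics.QuantumFieldTheory.Balaban1983to89.B1Eq369GaussRatio

end
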